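import Summits.CriticalPhenomena.Ising3DConformalLimit.Theses.SynchronousCoupling
import Summits.CriticalPhenomena.Ising3DConformalLimit.Theorems.ZoomMonotone.Negative.AxisStructureInsufficient
import Summits.CriticalPhenomena.Ising3DConformalLimit.Theorems.HyperoctahedralRPExistsScaleCovariantLimitCompactnessItemMapsDoubling
import HarnessLib

/-!
# Crux `UniformRegularity` (item stmt-CriticalPhenomena-4658) is NOT decided by the tree's axis-facts package:
# a tangent-envelope witness with every axis fact and NO doubling (standing crux disprover, cycle 1)

By landed theorems the crux is one scalar lattice statement: `UniformRegularity ⟺ TwoPointDoubling` (item 6150,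
`∃ κ > 0, ∀ n ≥ 1, κ·g(n) ≤ g(2n)`, `g(k) = ⟨σ₀σ_{k e₀}⟩⁺_{β_c(3)}`; `ItemMaps.uniformRegularity_iff_doubling`,
p120504). `AxisFacts g` (`ZoomMonotone/Negative/DoublingWitness`) packages EVERYTHING the tree knows about the
critical axis two-point function of `ℤ³` as a one-variable sequence: `g 0 = 1`, `0 < g ≤ 1`, nonincreasing
(Messager–Miracle-Solé), LOG-CONVEX with nondecreasing successive ratios `→ 1` (reflection positivity, ADC21
Prop. 5.3), and the Simon–Lieb / infrared window `c k⁻² ≤ g(k) ≤ C k⁻¹`; `axisFacts_criticalTwoPoint` checks the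
real `g` has them. The sibling refuter's witness `gW` there has all axis facts and a doubling ratio that never
SETTLES — but it IS doubling (`g(2k)/g(k) ∈ {1/4, 4^{-2/3}}`), so until now no tree theorem separated the axis-facts
package from doubling itself. This file does:

* `gT`, the TANGENT-ENVELOPE witness: `gT k = 2·exp(−L k)`, `L k = inf_j (log N_j + k/N_j)`, `N_j = 2^(2^j)` —
  the lower envelope of the tangent lines of `log` at the sparse scales `N_j` (`N_{j+1} = N_j²`). `L` is concave
  nondecreasing (an infimum of affine functions), `log k + 1 ≤ L k ≤ 2 log k + log 2 + 1`, so `gT` sits in the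
  window `e⁻¹ k⁻² ≤ gT ≤ (2/e) k⁻¹`; but between `N_j` and `N_j log N_j` the envelope follows ONE tangent line
  (an exponential episode `∝ e^{-k/N_j}` crossing the window from its infrared top to its Simon–Lieb bottom), and at
  `n_j = N_{j+1}·2^j` one gets `L(2n_j) − L(n_j) ≥ 2^j (2 log 2 − 1) → ∞`: `gT(2n_j)/gT(n_j) ≤ e^{-0.38·2^j} → 0`.
* `axisFacts_gT : AxisFacts gT` and `not_doubling_gT : ¬ ∃ κ > 0, ∀ n ≥ 1, κ·gT n ≤ gT (2n)`;
* `uniformRegularity_independent_of_axisFacts`: the real `g` has the axis facts, the crux is EQUIVALENT to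
  doubling of the real `g`, and `gT` has the axis facts without doubling. Hence NO argument from
  GKS/MMS monotonicity + RP log-convexity + the Simon–Lieb/infrared window alone proves (or refutes) the crux; a proof
  must import an input on `⟨σ₀σ_x⟩_{β_c}` beyond the package (the folklore "plateau-then-drop / crossover profiles
  are compatible with GKS/MMS/RP/IR", now kernel-checked in the exact currency of the tree). This is consistent with
  the landed localisation `FoldedCurrentRepulsion.not_doubling_level_lt` (RP alone: a non-doubling scale is a LIGHT
  scale `n g(n) ≪ 1` on an exponential episode) — `gT` fails doubling precisely at such scales.

Not claimed: `gT` is not asserted to be a Hausdorff moment sequence, nor to satisfy the off-axis Duminil-Copin–Panis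
lower bound (`dcp_criticalTwoPoint_axis_lower_holds`, which involves box sums of the full two-point function); the
package is the AXIS package `AxisFacts` exactly as catalogued by the tree.

References: M. Aizenman, H. Duminil-Copin, Ann. of Math. 194 (2021) = arXiv:1912.07973, Prop. 5.3, Remark 5.10
[AizenmanDuminilCopinAnnals2021]; A. Messager, S. Miracle-Solé, J. Stat. Phys. 17 (1977) 245; B. Simon, CMP 77
(1980) 111; J. Fröhlich, B. Simon, T. Spencer, CMP 50 (1976) 79.
-/

noncomputable section

open Real Finset Filter Set
open scoped Topology
open Literature.Probability.LatticeModels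
open Summit.CriticalPhenomena.Ising3DConformalLimit.Theorems.ZoomMonotone.Negative

namespace Summit.CriticalPhenomena.Ising3DConformalLimit.UniformRegularityNegative.TangentEnvelope

/-! ## The witness -/

/-- The sparse scales `N_j = 2^(2^j)` (so `N_{j+1} = N_j²`, `N_0 = 2`). [folklore] -/
def N (j : ℕ) : ℝ := (2:ℝ) ^ (2 ^ j)

/-- The tangent line of `log` at `N_j`, shifted up by one: `ℓ_j(k) = log N_j + k/N_j` (`≥ log k + 1`). [folklore] -/
def line (j k : ℕ) : ℝ := Real.log (N j) + (k:ℝ) / N j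

/-- The tangent envelope `L k = inf_j ℓ_j(k)` (concave, nondecreasing). [folklore] -/
def L (k : ℕ) : ℝ := ⨅ j : ℕ, line j k

/-- The witness `gT k = exp (log 2 − L k) = 2 e^{−L k}`. [folklore] -/
def gT (k : ℕ) : ℝ := Real.exp (Real.log 2 - L k)

/-- One-step increments of the envelope. [folklore] -/
def D (k : ℕ) : ℝ := L (k + 1) - L k

/-! ## The scales `N_j` -/

/-- `0 < N_j`. [folklore] -/
theorem N_pos (j : ℕ) : 0 < N j := by unfold N; positivity

/-- `2 ≤ N_j`. [folklore] -/
theorem two_le_N (j : ℕ) : 2 ≤ N j := by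
  unfold N
  calc (2:ℝ) = 2 ^ 1 := by norm_num
    _ ≤ 2 ^ (2 ^ j) := pow_le_pow_right₀ (by norm_num) Nat.one_le_two_pow

/-- `1 ≤ N_j`. [folklore] -/
theorem one_le_N (j : ℕ) : 1 ≤ N j := by linarith [two_le_N j]

/-- `N_0 = 2`. [folklore] -/
theorem N_zero : N 0 = 2 := by simp [N]

/-- `log N_j = 2^j log 2`. [folklore] -/
theorem log_N (j : ℕ) : Real.log (N j) = (2:ℝ) ^ j * Real.log 2 := by
  unfold N; rw [Real.log_pow]; push_cast; ring

/-- `N_{j+1} = N_j²`. [folklore] -/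
theorem N_succ (j : ℕ) : N (j + 1) = N j ^ 2 := by
  unfold N; rw [← pow_mul, pow_succ]

/-- `N` is nondecreasing. [folklore] -/
theorem N_mono : Monotone N := by
  intro i j hij
  unfold N
  exact pow_le_pow_right₀ (by norm_num) (Nat.pow_le_pow_right (by norm_num) hij)

/-! ## The envelope: bounds, monotonicity, concavity -/

/-- Tangent lines are nonnegative on `ℕ`. [folklore] -/
theorem line_nonneg (j k : ℕ) : 0 ≤ line j k :=
  add_nonneg (Real.log_nonneg (one_le_N j)) (div_nonneg (Nat.cast_nonneg k) (N_pos j).le)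

/-- The family of tangent-line values at `k` is bounded below (by `0`). [folklore] -/
theorem bddBelow_line (k : ℕ) : BddBelow (Set.range fun j => line j k) :=
  ⟨0, by rintro _ ⟨j, rfl⟩; exact line_nonneg j k⟩

/-- The envelope lies below every tangent line. [folklore] -/
theorem L_le (j k : ℕ) : L k ≤ line j k := ciInf_le (bddBelow_line k) j

/-- A common lower bound of the tangent lines bounds the envelope from below. [folklore] -/
theorem le_L {k : ℕ} {b : ℝ} (h : ∀ j, b ≤ line j k) : b ≤ L k := le_ciInf h

/-- `L 0 = log 2`. [folklore] -/
theorem L_zero : L 0 = Real.log 2 := by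
  apply le_antisymm
  · have h := L_le 0 0
    rw [line, N_zero, Nat.cast_zero, zero_div, add_zero] at h
    exact h
  · refine le_L fun j => ?_
    rw [line, Nat.cast_zero, zero_div, add_zero, log_N]
    have h1 : (1:ℝ) ≤ 2 ^ j := one_le_pow₀ (by norm_num)
    nlinarith [Real.log_pos (show (1:ℝ) < 2 by norm_num)]

/-- The envelope is nondecreasing (one step). [folklore] -/
theorem L_succ_le (k : ℕ) : L k ≤ L (k + 1) := by
  refine le_L fun j => (L_le j k).trans ?_
  unfold line
  gcongr
  · exact (N_pos j).le
  · exact_mod_cast Nat.le_succ k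

/-- The envelope is nondecreasing. [folklore] -/
theorem L_monotone : Monotone L := monotone_nat_of_le_succ L_succ_le

/-- Midpoint concavity of the envelope (an infimum of affine functions). [folklore] -/
theorem L_concave (m : ℕ) : L m + L (m + 2) ≤ 2 * L (m + 1) := by
  have h : ∀ j, (L m + L (m + 2)) / 2 ≤ line j (m + 1) := by
    intro j
    have h1 := L_le j m
    have h2 := L_le j (m + 2)
    have h3 : line j m + line j (m + 2) = 2 * line j (m + 1) := by
      unfold line; push_cast; ring
    linarith
  have := le_L h
  linarith

/-- Increments are nonnegative. [folklore] -/
theorem D_nonneg (k : ℕ) : 0 ≤ D k := sub_nonneg.2 (L_succ_le k)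

/-- Increments are nonincreasing (concavity). [folklore] -/
theorem D_antitone : Antitone D := by
  refine antitone_nat_of_succ_le fun k => ?_
  unfold D
  have := L_concave k
  linarith

/-- The tangent-line inequality: `log k + 1 ≤ ℓ_j(k)` for `k ≥ 1`. [folklore] -/
theorem log_le_line {k : ℕ} (hk : 1 ≤ k) (j : ℕ) : Real.log k + 1 ≤ line j k := by
  have hkpos : (0:ℝ) < k := by exact_mod_cast hk
  have h := Real.log_le_sub_one_of_pos (div_pos hkpos (N_pos j))
  rw [Real.log_div hkpos.ne' (N_pos j).ne'] at h
  unfold line; linarith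

/-- `log k + 1 ≤ L k` for `k ≥ 1`. [folklore] -/
theorem L_lower {k : ℕ} (hk : 1 ≤ k) : Real.log k + 1 ≤ L k := le_L (log_le_line hk)

/-- The envelope stays below `2 log k + log 2 + 1`: use the first scale `N_j ≥ k` (then `N_{j-1} < k ≤ N_{j-1}²`). [folklore] -/
theorem L_upper {k : ℕ} (hk : 1 ≤ k) : L k ≤ 2 * Real.log k + (Real.log 2 + 1) := by
  classical
  have hkpos : (0:ℝ) < k := by exact_mod_cast hk
  have hlogk : 0 ≤ Real.log k := Real.log_nonneg (by exact_mod_cast hk)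
  have hex : ∃ j : ℕ, (k:ℝ) ≤ N j := by
    refine ⟨k, ?_⟩
    unfold N
    calc (k:ℝ) ≤ 2 ^ k := by exact_mod_cast (Nat.lt_two_pow_self).le
      _ ≤ 2 ^ (2 ^ k) := pow_le_pow_right₀ (by norm_num) (Nat.lt_two_pow_self).le
  have hspec := Nat.find_spec hex
  rcases h0 : Nat.find hex with _ | j
  · -- `k ≤ N 0 = 2`
    rw [h0, N_zero] at hspec
    calc L k ≤ line 0 k := L_le 0 k
      _ = Real.log 2 + k / 2 := by rw [line, N_zero]
      _ ≤ Real.log 2 + 1 := by linarith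
      _ ≤ 2 * Real.log k + (Real.log 2 + 1) := by linarith
  · rw [h0] at hspec
    have hlt : ¬ ((k:ℝ) ≤ N j) := Nat.find_min hex (by rw [h0]; exact Nat.lt_succ_self j)
    push Not at hlt
    have hNj : Real.log (N j) < Real.log k := Real.log_lt_log (N_pos j) hlt
    calc L k ≤ line (j + 1) k := L_le (j + 1) k
      _ = 2 * Real.log (N j) + k / N (j + 1) := by
          rw [line, N_succ, Real.log_pow]; push_cast; ring
      _ ≤ 2 * Real.log (N j) + 1 := by
          have : (k:ℝ) / N (j + 1) ≤ 1 := (div_le_one (N_pos _)).2 hspec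
          linarith
      _ ≤ 2 * Real.log k + (Real.log 2 + 1) := by
          linarith [Real.log_pos (show (1:ℝ) < 2 by norm_num)]

/-- The increments tend to `0`: `0 ≤ D k ≤ (L(k+1) − L 0)/(k+1) ≤ (2 log (k+1) + 1)/(k+1)`. [folklore] -/
theorem D_tendsto_zero : Tendsto D atTop (𝓝 0) := by
  have hbound : ∀ k : ℕ, D k ≤ (2 * Real.log ((k:ℝ) + 1) + 1) / ((k:ℝ) + 1) := by
    intro k
    have hk1 : (0:ℝ) < (k:ℝ) + 1 := by positivity
    -- `(k+1) D k ≤ Σ_{i ≤ k} D i = L (k+1) - L 0`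
    have hsum : ∑ i ∈ Finset.range (k + 1), D i = L (k + 1) - L 0 := Finset.sum_range_sub L (k + 1)
    have hle : ((k:ℝ) + 1) * D k ≤ ∑ i ∈ Finset.range (k + 1), D i := by
      have : ∑ _i ∈ Finset.range (k + 1), D k ≤ ∑ i ∈ Finset.range (k + 1), D i :=
        Finset.sum_le_sum fun i hi => D_antitone (Nat.lt_succ_iff.1 (Finset.mem_range.1 hi))
      rw [Finset.sum_const, Finset.card_range, nsmul_eq_mul] at this
      push_cast at this
      exact this
    have hup : L (k + 1) - L 0 ≤ 2 * Real.log ((k:ℝ) + 1) + 1 := by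
      have := L_upper (k := k + 1) (by omega)
      rw [L_zero]; push_cast at this; linarith
    rw [le_div_iff₀ hk1, mul_comm]
    linarith
  have hlim : Tendsto (fun k : ℕ => (2 * Real.log ((k:ℝ) + 1) + 1) / ((k:ℝ) + 1)) atTop (𝓝 0) := by
    have hx : Tendsto (fun k : ℕ => (k:ℝ) + 1) atTop atTop :=
      tendsto_natCast_atTop_atTop.atTop_add tendsto_const_nhds
    have h1 : Tendsto (fun x : ℝ => Real.log x ^ 1 / (1 * x + 0)) atTop (𝓝 0) :=
      Real.tendsto_pow_log_div_mul_add_atTop 1 0 1 one_ne_zero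
    have h2 : Tendsto (fun x : ℝ => 2 * (Real.log x ^ 1 / (1 * x + 0)) + x⁻¹) atTop (𝓝 (2 * 0 + 0)) :=
      (h1.const_mul 2).add tendsto_inv_atTop_zero
    rw [mul_zero, add_zero] at h2
    have h3 := h2.comp hx
    refine h3.congr' ?_
    filter_upwards [eventually_ge_atTop 0] with k _
    have hk1 : ((k:ℝ) + 1) ≠ 0 := by positivity
    simp only [Function.comp, pow_one, one_mul, add_zero]
    field_simp
  exact squeeze_zero (fun k => D_nonneg k) hbound hlim

/-! ## The witness has every axis fact -/

/-- `0 < gT k`. [folklore] -/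
theorem gT_pos (k : ℕ) : 0 < gT k := Real.exp_pos _

/-- Successive ratios of the witness: `gT(k+1)/gT(k) = e^{-D k}`. [folklore] -/
theorem gT_succ_div (k : ℕ) : gT (k + 1) / gT k = Real.exp (-(D k)) := by
  unfold gT D; rw [← Real.exp_sub]; congr 1; ring

/-- **The tangent-envelope witness has every property in `AxisFacts`.** [folklore] -/
theorem axisFacts_gT : AxisFacts gT where
  zero := by unfold gT; rw [L_zero, sub_self, Real.exp_zero]
  pos := gT_pos
  le_one := by
    intro k
    unfold gT
    rw [Real.exp_le_one_iff, sub_nonpos, ← L_zero]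
    exact L_monotone (Nat.zero_le k)
  anti := by
    intro k m hkm
    unfold gT
    exact Real.exp_le_exp.2 (by linarith [L_monotone hkm])
  logConvex := by
    intro n hn
    obtain ⟨m, rfl⟩ : ∃ m, n = m + 1 := ⟨n - 1, by omega⟩
    rw [Nat.add_sub_cancel]
    unfold gT
    rw [sq, ← Real.exp_add, ← Real.exp_add]
    exact Real.exp_le_exp.2 (by linarith [L_concave m])
  ratioMono := by
    intro k m hkm
    simp only
    rw [gT_succ_div (k + 1), gT_succ_div (m + 1)]
    exact Real.exp_le_exp.2 (neg_le_neg (D_antitone (by omega)))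
  ratioTendsto := by
    have h : Tendsto (fun k => Real.exp (-(D k))) atTop (𝓝 (Real.exp (-0))) :=
      (Real.continuous_exp.tendsto _).comp D_tendsto_zero.neg
    rw [neg_zero, Real.exp_zero] at h
    refine h.congr' (Eventually.of_forall fun k => ?_)
    exact (gT_succ_div k).symm
  lower := by
    refine ⟨Real.exp (-1), Real.exp_pos _, fun k hk => ?_⟩
    have hkpos : (0:ℝ) < k := by exact_mod_cast hk
    have hk2 : (k:ℝ) ^ 2 = Real.exp (2 * Real.log k) := by
      rw [show (2 : ℝ) * Real.log k = ((2:ℕ):ℝ) * Real.log k by norm_num, Real.exp_nat_mul,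
        Real.exp_log hkpos]
    unfold gT
    rw [hk2, ← Real.exp_sub]
    exact Real.exp_le_exp.2 (by linarith [L_upper hk])
  upper := by
    refine ⟨2 / Real.exp 1, fun k hk => ?_⟩
    have hkpos : (0:ℝ) < k := by exact_mod_cast hk
    unfold gT
    calc Real.exp (Real.log 2 - L k) ≤ Real.exp (Real.log 2 - 1 - Real.log k) :=
          Real.exp_le_exp.2 (by linarith [L_lower hk])
      _ = 2 / Real.exp 1 / k := by
          rw [Real.exp_sub, Real.exp_sub, Real.exp_log two_pos, Real.exp_log hkpos]

/-! ## … and is not doubling -/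

/-- At the scales `n_j = N_{j+1}·2^j`: `L(n_j) ≤ 2^{j+1} log 2 + 2^j` (the tangent line at `N_{j+1}`). [folklore] -/
theorem L_at_scale_le (j : ℕ) :
    L (2 ^ (2 ^ (j + 1) + j)) ≤ (2:ℝ) ^ (j + 1) * Real.log 2 + 2 ^ j := by
  calc L (2 ^ (2 ^ (j + 1) + j)) ≤ line (j + 1) (2 ^ (2 ^ (j + 1) + j)) := L_le _ _
    _ = (2:ℝ) ^ (j + 1) * Real.log 2 + 2 ^ j := by
        rw [line, log_N]
        congr 1
        unfold N
        rw [div_eq_iff (by positivity)]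
        push_cast
        ring

/-- … while `L(2 n_j) ≥ 2^{j+2} log 2` (every tangent line is that high at `2n_j = N_{j+1}·2^{j+1}`). [folklore] -/
theorem le_L_at_double_scale (j : ℕ) :
    (2:ℝ) ^ (j + 2) * Real.log 2 ≤ L (2 * 2 ^ (2 ^ (j + 1) + j)) := by
  have hlog2 : Real.log 2 ≤ 1 := by linarith [Real.log_two_lt_d9]
  have hlog2pos : 0 < Real.log 2 := Real.log_pos (by norm_num)
  have hcast : ((2 * 2 ^ (2 ^ (j + 1) + j) : ℕ) : ℝ) = N (j + 1) * 2 ^ (j + 1) := by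
    unfold N; push_cast; ring
  refine le_L fun i => ?_
  rw [line, hcast, log_N]
  rcases lt_trichotomy i (j + 1) with hi | rfl | hi
  · -- `i ≤ j`: the slope term alone is `≥ N_{j+1} 2^{j+1} / N_j = N_j 2^{j+1} ≥ 2^{j+2}`
    have hi' : i ≤ j := by omega
    have hNi : N i ≤ N j := N_mono hi'
    have h1 : N (j + 1) * 2 ^ (j + 1) / N j ≤ N (j + 1) * 2 ^ (j + 1) / N i :=
      div_le_div_of_nonneg_left (mul_nonneg (N_pos _).le (by positivity)) (N_pos i) hNi
    have h2 : N (j + 1) * 2 ^ (j + 1) / N j = N j * 2 ^ (j + 1) := by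
      rw [N_succ, div_eq_iff (N_pos j).ne']; ring
    have h3 : (2:ℝ) ^ (j + 2) * Real.log 2 ≤ N j * 2 ^ (j + 1) := by
      calc (2:ℝ) ^ (j + 2) * Real.log 2 ≤ 2 ^ (j + 2) * 1 := by gcongr
        _ = 2 * 2 ^ (j + 1) := by ring
        _ ≤ N j * 2 ^ (j + 1) := by gcongr; exact two_le_N j
    have h4 : 0 ≤ (2:ℝ) ^ i * Real.log 2 := by positivity
    linarith
  · -- `i = j+1`: `2^{j+1} log 2 + 2^{j+1} ≥ 2^{j+2} log 2`
    rw [mul_div_cancel_left₀ _ (N_pos _).ne']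
    have : (2:ℝ) ^ (j + 2) = 2 * 2 ^ (j + 1) := by ring
    rw [this]
    nlinarith [pow_pos (show (0:ℝ) < 2 by norm_num) (j + 1)]
  · -- `i ≥ j+2`: the constant term alone is `2^i log 2 ≥ 2^{j+2} log 2`
    have h1 : (2:ℝ) ^ (j + 2) ≤ 2 ^ i := pow_le_pow_right₀ (by norm_num) (by omega)
    have h2 : 0 ≤ N (j + 1) * 2 ^ (j + 1) / N i :=
      div_nonneg (mul_nonneg (N_pos _).le (by positivity)) (N_pos i).le
    nlinarith

/-- **The witness is not doubling**: `gT(2n_j) < κ·gT(n_j)` as soon as `2^j (2 log 2 − 1) > −log κ`. [folklore] -/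
theorem not_doubling_gT : ¬ ∃ κ : ℝ, 0 < κ ∧ ∀ n : ℕ, 1 ≤ n → κ * gT n ≤ gT (2 * n) := by
  rintro ⟨κ, hκ, h⟩
  have hc₀ : 0 < 2 * Real.log 2 - 1 := by linarith [Real.log_two_gt_d9]
  obtain ⟨j, hj⟩ := pow_unbounded_of_one_lt (-Real.log κ / (2 * Real.log 2 - 1)) (show (1:ℝ) < 2 by norm_num)
  have hj' : -Real.log κ < 2 ^ j * (2 * Real.log 2 - 1) := by rwa [div_lt_iff₀ hc₀] at hj
  set n : ℕ := 2 ^ (2 ^ (j + 1) + j) with hn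
  have hn1 : 1 ≤ n := Nat.one_le_two_pow
  have hgap : -Real.log κ < L (2 * n) - L n := by
    have h1 := L_at_scale_le j
    have h2 := le_L_at_double_scale j
    have h3 : (2:ℝ) ^ (j + 2) * Real.log 2 - ((2:ℝ) ^ (j + 1) * Real.log 2 + 2 ^ j) =
        2 ^ j * (2 * Real.log 2 - 1) := by ring
    rw [hn]; linarith
  have hlt : gT (2 * n) < κ * gT n := by
    unfold gT
    rw [← Real.exp_log hκ, ← Real.exp_add, Real.exp_lt_exp]
    linarith
  exact absurd (h n hn1) (not_le.2 hlt)

/-- **Some `g` has every axis fact and is not doubling.** [folklore] -/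
theorem axisFacts_not_sufficient_for_doubling :
    ∃ g : ℕ → ℝ, AxisFacts g ∧ ¬ ∃ κ : ℝ, 0 < κ ∧ ∀ n : ℕ, 1 ≤ n → κ * g n ≤ g (2 * n) :=
  ⟨gT, axisFacts_gT, not_doubling_gT⟩

/-! ## Reading for the crux -/

/-- Item 6150 `TwoPointDoubling` is doubling of the axis sequence `gAxis k = ⟨σ₀σ_{k e₀}⟩_{β_c(3)}` in the abstract
shape used above. [folklore] -/
theorem twoPointDoubling_iff_gAxis :
    Summit.CriticalPhenomena.Ising3DConformalLimit.Theses.MirrorHoelderCompactness.TwoPointDoubling ↔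
      ∃ κ : ℝ, 0 < κ ∧ ∀ n : ℕ, 1 ≤ n → κ * gAxis n ≤ gAxis (2 * n) := by
  unfold Summit.CriticalPhenomena.Ising3DConformalLimit.Theses.MirrorHoelderCompactness.TwoPointDoubling gAxis
  have hcast : ∀ n : ℕ, ((2 * n : ℕ) : ℤ) = 2 * (n : ℤ) := fun n => by push_cast; ring
  simp_rw [hcast]

/-- **The crux is EQUIVALENT to doubling of the real axis sequence** (landed item map 4658 ⟺ 6150, read in the
`SynchronousCoupling` namespace, whose decl is verbatim the `MonotoneRG` one). [cite: AizenmanDuminilCopinAnnals2021, arXiv:1912.07973 Remark 5.10] -/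
theorem uniformRegularity_iff_gAxis_doubling :
    Summit.CriticalPhenomena.Ising3DConformalLimit.Theses.SynchronousCoupling.UniformRegularity ↔
      ∃ κ : ℝ, 0 < κ ∧ ∀ n : ℕ, 1 ≤ n → κ * gAxis n ≤ gAxis (2 * n) := by
  rw [← twoPointDoubling_iff_gAxis]
  exact Summit.CriticalPhenomena.Ising3DConformalLimit.Cruxes.ExistsScaleCovariantLimit.TwoHierarchies.ItemMaps.uniformRegularity_iff_doubling

/-- **NEGATIVE LEMMA (model-blind strengthening refuted).** The real axis two-point function has every axis fact,
the crux `UniformRegularity` is EQUIVALENT to its doubling, and yet a sequence with every axis fact fails doubling: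
the crux is independent of the tree's axis-facts package (GKS/MMS monotonicity, RP log-convexity and ratio limit,
Simon–Lieb/infrared window). Any proof — or disproof — must use more about `⟨σ₀σ_x⟩_{β_c}` on `ℤ³`. [folklore] -/
theorem uniformRegularity_independent_of_axisFacts :
    (AxisFacts gAxis ∧
      (Summit.CriticalPhenomena.Ising3DConformalLimit.Theses.SynchronousCoupling.UniformRegularity ↔
        ∃ κ : ℝ, 0 < κ ∧ ∀ n : ℕ, 1 ≤ n → κ * gAxis n ≤ gAxis (2 * n))) ∧
      ∃ g : ℕ → ℝ, AxisFacts g ∧ ¬ ∃ κ : ℝ, 0 < κ ∧ ∀ n : ℕ, 1 ≤ n → κ * g n ≤ g (2 * n) :=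
  ⟨⟨axisFacts_criticalTwoPoint, uniformRegularity_iff_gAxis_doubling⟩, axisFacts_not_sufficient_for_doubling⟩

end Summit.CriticalPhenomena.Ising3DConformalLimit.UniformRegularityNegative.TangentEnvelope

end
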